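import Summits.QuantumFields.BalabanUV.T4Continuum.Spine.NE1p.DressedSmallFieldMixedDerivativeLetter

/-!
# T⁴ programme, spine estimate NE1′ (node O3b/H2) — DIMOCK's `∂∕∂s_{Z−Y}` DOES NOT DEPEND ON THE ENUMERATION: for a function ANALYTIC on an
# open set, the template lineage's list-indexed kernel mixed derivative `PolydiscCauchyBounds.mixedDeriv l g` is invariant under permutations
# of `l` on that set (symmetry of mixed slice derivatives, from Mathlib's symmetric second Fréchet derivative of analytic maps) — the kernel
# content of the Literature module's declared reading (ii) «one derivative per cube of Z − Y, in any order»; hence W55's angular contours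
# represent `∂_l F` for EVERY repetition-free enumeration `l` of the active cubes, not only the bridge's increasing `enumS S`

Cell `pub-balaban`, sub-cell `t4`, row NE1′ formalisation crew (`t4/formal/NE1p/LEAVES.md` row W⟨next⟩ — own-initiative follower of the unit's W55
under typer R-T61 (ii)), unit `b2b-balaban-t4-ne1p-formalise-leaf-08` (gen 11).  ADDITIVE — imports W55 PART 2
`Spine/NE1p/DressedSmallFieldMixedDerivativeLetter` ONLY (→ PART 1 `…Bridge` → W39.1 + Literature `Dimock2011to13/PolydiscCauchyBounds`: `pderiv`,
`mixedDeriv`, `mixedDeriv_nil`, `mixedDeriv_cons`, `pderiv_eq_fderiv_apply`, `analyticOnNhd_mixedDeriv` BY NAME); THEOREMS ONLY (0 def, 0 `def … : Prop`,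
0 cite, 0 sorry, 0 `attribute`) + 1 decided `example`; nothing of W55 ∕ the Literature module restated — in particular NO new derivative object.

WHY THIS FILE.  `PolydiscCauchyBounds` (the cell's kernel of [Dimock2013] §4.5 Lemma 19) defines `∂∕∂s_{Z−Y}` as `mixedDeriv l g` along a LIST
`l` and declares the reading «(ii) `∂∕∂s_{Z−Y}` = one derivative per cube of `Z − Y`, in any order (a `List.Nodup` enumeration)» — the
independence of the order is READ there, not proved.  [Balaban1988RGII]'s (1.23)∕(2.14) «Π_{Δ⊂…} ∫ ds(Δ) (1∕2πi) ∫ dσ(Δ)∕(σ(Δ) − s(Δ))²» is likewise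
an unordered product over cubes (p. 7, p. 15 — LOCI, TYPE∕CONTEXT only), and W55's bridge had to FIX an enumeration (`enumS S`, increasing).
This file proves the order-independence for analytic functions and removes the choice:
* §1 `eventuallyEq_slice`, `pderiv_congr_of_eventuallyEq`, `pderiv_congr_eqOn`, `mixedDeriv_congr_eqOn` (slice∕mixed derivatives of functions
  agreeing near a point ∕ on an open set agree there — Mathlib `Filter.EventuallyEq.deriv_eq`); **`pderiv_pderiv_eq_fderiv_fderiv`** (on an open
  set of analyticity `∂_i∂_j g(s) = D²g(s)(e_i)(e_j)` — `pderiv_eq_fderiv_apply` twice, `HasFDerivAt.clm_apply`, `AnalyticAt.fderiv`);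
  **`pderiv_comm`**: `∂_i∂_j g = ∂_j∂_i g` on `U` — Mathlib `ContDiffAt.isSymmSndFDerivAt_of_omega` (analytic ⇒ `C^ω` ⇒ symmetric `D²`).
* §2 **`mixedDeriv_perm`**: `l ~ l'` ⇒ `∂_l g = ∂_{l'} g` on `U` (induction on `List.Perm`: `cons` by §1's congruence on the OPEN set, `swap` by
  `pderiv_comm` applied to the analytic `∂_l g` — Dimock's `analyticOnNhd_mixedDeriv` BY NAME —, `trans`); `mixedDeriv_eq_of_nodup_of_mem_iff`
  (Batteries `List.perm_ext_iff_of_nodup`).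
* §3 **`mixedDerivLetter_rep_of_nodup`**: W55 PART 2's `mixedDerivLetter_rep` holds with `mixedDeriv l F (basePt S s)` on the right for EVERY
  `l.Nodup` enumerating `S`; decided `example`: on two cubes the DECREASING `[1, 0]` for the non-product entire `exp(z₀z₁)`.

HONEST FRAMING.  [folklore] calculus (symmetry of second derivatives of analytic maps, from Mathlib; congruence of slice derivatives under local
agreement; a `List.Perm` induction) on the template lineage's kernel objects, BY NAME; it SUPPORTS the Literature module's declared reading (ii)
with a kernel proof and is placed HERE (Summits side) because it is OUR lemma, not a statement [Dimock2013] prints (the template lineage may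
re-home it by a by-name re-export; no hold asked); the hypothesis is analyticity on an OPEN set (as Lemma 19's kernel); no numeral of print;
no estimate of print; `F` ↔ print's s(Δ)-dependent operator products is a TYPE READING; (B1) for Bałaban's (2.14) NOT discharged; (B3) = GAPS
G-ne9p2-5 UNPRINTED — NOT discharged, untouched; (B5) untouched; 0 binders instantiated on Bałaban's densities ∕ operators ∕ (2.14) data ∕ `d_k` ∕
minimisers ∕ backgrounds; discharges no wall item; wall v1.7 (T4-DAG v47) does NOT move; R-t4r2-Q2 NOT met thereby; NE1′ ⇐ the named binders —
NOT proved, NOT printed; spine PROVED 0∕9; count 9 unchanged.  Rung (B)+1 on ONE finite four-torus — NOT infinite volume, NOT a mass gap, NOT OS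
on ℝ⁴, NOT Clay.  ABSOLUTE RULE honoured: [Balaban1988RGII] (CMP 116 (1988) 1–22, pp. 7, 15) LOCI TYPE∕CONTEXT only; [Dimock2013] enters only
through the cite-tagged Literature module BY NAME; nothing internally minted is cited; [folklore] tags on kernel lemmas only.  HONEST DEPENDENCY: continuum YM on T⁴ ⇐ BetaPertH ∧ nine spine estimates (0/9 proved); BetaPertH ⇐ (D1) ∧ (D4) ∧
CAP+tail; G-an2-4 gates asym, D1 and NE2/3/4.
-/

noncomputable section

namespace Summit.QuantumFields.BalabanUV.T4Continuum.NE1p.DressedSmallFieldMixedDerivativeSymmetric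

open MeasureTheory Metric Set Complex Finset Function Filter
open scoped BigOperators Topology
open Summit.QuantumFields.BalabanUV.T4Continuum.B13TermContours
open Summit.QuantumFields.BalabanUV.T4Continuum.NE1p.DressedSmallFieldMixedLetter
open Summit.QuantumFields.BalabanUV.T4Continuum.NE1p.DressedSmallFieldMixedDerivativeBridge
open Summit.QuantumFields.BalabanUV.T4Continuum.NE1p.DressedSmallFieldMixedDerivativeLetter
open Literature.MathematicalPhysics.QuantumFieldTheory.Dimock2011to13.PolydiscCauchyBounds
  (pderiv mixedDeriv mixedDeriv_nil mixedDeriv_cons pderiv_eq_fderiv_apply analyticOnNhd_pderiv analyticOnNhd_mixedDeriv)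

variable {ι : Type*} [Fintype ι] [DecidableEq ι]

/-! ## §1 Slice derivatives of functions that agree near a point agree; a slice derivative is a Fréchet derivative on an open set -/

omit [Fintype ι] in
/-- [folklore] Near `s`, the slice `t ↦ update s i t` stays in any neighbourhood of `s`: if `f = g` near `s` then the slices of `f` and
`g` through `s` in direction `i` agree near `t = s i`. -/
theorem eventuallyEq_slice {f g : (ι → ℂ) → ℂ} {s : ι → ℂ} (h : f =ᶠ[𝓝 s] g) (i : ι) :
    (fun t : ℂ => f (update s i t)) =ᶠ[𝓝 (s i)] (fun t : ℂ => g (update s i t)) := by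
  have hc : Continuous fun t : ℂ => update s i t := (continuous_update i).comp (Continuous.prodMk_right s)
  have ht : Tendsto (fun t : ℂ => update s i t) (𝓝 (s i)) (𝓝 s) := by
    have := hc.tendsto (s i)
    rwa [update_eq_self] at this
  exact ht.eventually h

omit [Fintype ι] in
/-- [folklore] **`pderiv` respects local agreement**: if `f = g` near `s` then `∂_i f (s) = ∂_i g (s)`. -/
theorem pderiv_congr_of_eventuallyEq {f g : (ι → ℂ) → ℂ} {s : ι → ℂ} (h : f =ᶠ[𝓝 s] g) (i : ι) :
    pderiv i f s = pderiv i g s := by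
  unfold pderiv
  exact (eventuallyEq_slice h i).deriv_eq

omit [Fintype ι] in
/-- [folklore] On an OPEN set, functions that agree on the set have the same slice derivatives on the set. -/
theorem pderiv_congr_eqOn {U : Set (ι → ℂ)} (hU : IsOpen U) {f g : (ι → ℂ) → ℂ} (h : EqOn f g U) (i : ι) :
    EqOn (pderiv i f) (pderiv i g) U := fun _ hs =>
  pderiv_congr_of_eventuallyEq (h.eventuallyEq_of_mem (hU.mem_nhds hs)) i

omit [Fintype ι] in
/-- [folklore] … hence the same mixed derivatives on the set. -/
theorem mixedDeriv_congr_eqOn {U : Set (ι → ℂ)} (hU : IsOpen U) {f g : (ι → ℂ) → ℂ} (h : EqOn f g U) :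
    ∀ l : List ι, EqOn (mixedDeriv l f) (mixedDeriv l g) U
  | [] => by simpa using h
  | i :: l => by
      rw [mixedDeriv_cons, mixedDeriv_cons]
      exact pderiv_congr_eqOn hU (mixedDeriv_congr_eqOn hU h l) i

/-- [folklore] **THE ITERATED SLICE DERIVATIVE IS THE SECOND FRÉCHET DERIVATIVE ON THE COORDINATE VECTORS**: for `g` analytic on an open
`U ∋ s`, `∂_i ∂_j g (s) = D²g(s)(e_i)(e_j)` (`e_k = Pi.single k 1`). -/
theorem pderiv_pderiv_eq_fderiv_fderiv {U : Set (ι → ℂ)} (hU : IsOpen U) {g : (ι → ℂ) → ℂ} (hg : AnalyticOnNhd ℂ g U)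
    (i j : ι) {s : ι → ℂ} (hs : s ∈ U) :
    pderiv i (pderiv j g) s = fderiv ℂ (fderiv ℂ g) s (Pi.single i 1) (Pi.single j 1) := by
  -- near `s`, `∂_j g` is the Fréchet derivative applied to `e_j`
  have hloc : pderiv j g =ᶠ[𝓝 s] fun x => fderiv ℂ g x (Pi.single j 1) := by
    filter_upwards [hU.mem_nhds hs] with x hx
    exact pderiv_eq_fderiv_apply j (hg x hx).differentiableAt
  rw [pderiv_congr_of_eventuallyEq hloc i]
  -- the slice derivative of `x ↦ Dg(x) e_j` in direction `e_i`
  have hD : HasFDerivAt (fderiv ℂ g) (fderiv ℂ (fderiv ℂ g) s) s := ((hg s hs).fderiv.differentiableAt).hasFDerivAt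
  have happ : HasFDerivAt (fun x => fderiv ℂ g x (Pi.single j 1))
      ((fderiv ℂ g s).comp (0 : (ι → ℂ) →L[ℂ] (ι → ℂ)) + (fderiv ℂ (fderiv ℂ g) s).flip (Pi.single j 1)) s :=
    hD.clm_apply (hasFDerivAt_const (Pi.single j 1 : ι → ℂ) s)
  rw [pderiv_eq_fderiv_apply i happ.differentiableAt, happ.fderiv]
  simp

/-- **SYMMETRY OF THE MIXED SLICE DERIVATIVES** (kernel; Mathlib `ContDiffAt.isSymmSndFDerivAt_of_omega` — an analytic function has a symmetric
second derivative): for `g` analytic on an open `U`, `∂_i ∂_j g = ∂_j ∂_i g` on `U`. [folklore] -/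
theorem pderiv_comm {U : Set (ι → ℂ)} (hU : IsOpen U) {g : (ι → ℂ) → ℂ} (hg : AnalyticOnNhd ℂ g U) (i j : ι) :
    EqOn (pderiv i (pderiv j g)) (pderiv j (pderiv i g)) U := fun s hs => by
  rw [pderiv_pderiv_eq_fderiv_fderiv hU hg i j hs, pderiv_pderiv_eq_fderiv_fderiv hU hg j i hs]
  exact ((hg s hs).contDiffAt.isSymmSndFDerivAt_of_omega) (Pi.single i 1) (Pi.single j 1)

/-! ## §2 DIMOCK's `∂∕∂s_{Z−Y}` DOES NOT DEPEND ON THE ENUMERATION -/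

/-- **`mixedDeriv` IS INVARIANT UNDER PERMUTATIONS OF THE LIST** (kernel; induction on `List.Perm` — `cons` by §1's congruence on the open set,
`swap` by `pderiv_comm` applied to the analytic `∂_l g`, `trans`): for `g` analytic on an open `U` and `l ~ l'`, `∂_l g = ∂_{l'} g` on `U`.
This is the kernel content of the Literature module's declared reading (ii) «`∂∕∂s_{Z−Y}` = one derivative per cube of `Z − Y`, in any order». [folklore] -/
theorem mixedDeriv_perm {U : Set (ι → ℂ)} (hU : IsOpen U) {g : (ι → ℂ) → ℂ} (hg : AnalyticOnNhd ℂ g U) {l l' : List ι}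
    (hp : l.Perm l') : EqOn (mixedDeriv l g) (mixedDeriv l' g) U := by
  induction hp with
  | nil => exact fun _ _ => rfl
  | cons i _ ih =>
      rw [mixedDeriv_cons, mixedDeriv_cons]
      exact pderiv_congr_eqOn hU ih i
  | swap i j l =>
      rw [mixedDeriv_cons, mixedDeriv_cons, mixedDeriv_cons, mixedDeriv_cons]
      exact pderiv_comm hU (analyticOnNhd_mixedDeriv hU hg l) j i
  | trans _ _ ih₁ ih₂ => exact ih₁.trans ih₂

/-- **… hence under re-enumeration**: two repetition-free lists with the same members give the same mixed derivative on `U` (Batteries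
`List.perm_ext_iff_of_nodup`). [folklore] -/
theorem mixedDeriv_eq_of_nodup_of_mem_iff {U : Set (ι → ℂ)} (hU : IsOpen U) {g : (ι → ℂ) → ℂ} (hg : AnalyticOnNhd ℂ g U)
    {l l' : List ι} (hl : l.Nodup) (hl' : l'.Nodup) (h : ∀ i, i ∈ l ↔ i ∈ l') :
    EqOn (mixedDeriv l g) (mixedDeriv l' g) U :=
  mixedDeriv_perm hU hg ((List.perm_ext_iff_of_nodup hl hl').2 h)

/-! ## §3 CONSEQUENCE FOR THE LETTER: W55's angular contours represent `∂_l F` for EVERY enumeration `l` of the active cubes -/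

variable {n : ℕ}

/-- **THE INNER CONTOURS REPRESENT `∂_l F` FOR EVERY REPETITION-FREE ENUMERATION `l` OF `S`** (W55 PART 2 `mixedDerivLetter_rep` + §2 at
`U = univ` with part 1's `mem_enumS`∕`enumS_nodup`): the particular increasing enumeration `enumS S` of the bridge is immaterial. [folklore] -/
theorem mixedDerivLetter_rep_of_nodup (r : Fin n → ℝ) (S : Finset (Fin n)) (F : (Fin n → ℂ) → ℂ) (s : Fin n → ℝ)
    (hr : ∀ j, 1 < r j) (hF : AnalyticOnNhd ℂ F univ) (hs : ∀ j ∈ S, s j ∈ Icc (0 : ℝ) 1)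
    {l : List (Fin n)} (hl : l.Nodup) (hmem : ∀ j, j ∈ l ↔ j ∈ S) :
    ∫ θ, wS r S (pairθ s θ) * F (σS r S (pairθ s θ)) ∂(Measure.pi (θS S)) = mixedDeriv l F (basePt S s) := by
  rw [mixedDerivLetter_rep n r S F s hr hF hs]
  exact (mixedDeriv_eq_of_nodup_of_mem_iff isOpen_univ hF (enumS_nodup n S) hl
    (fun j => (mem_enumS n S j).trans (hmem j).symm)) (mem_univ _)

/-- DECIDED CHECK: on two cubes the DECREASING enumeration `[1, 0]` gives the same letter value as the bridge's `[0, 1]` — for the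
non-product entire factor `exp(z₀z₁)` at any `s ∈ [0,1]²` and radii `> 1`. -/
example (r : Fin 2 → ℝ) (hr : ∀ j, 1 < r j) (s : Fin 2 → ℝ) (hs : ∀ j, s j ∈ Icc (0 : ℝ) 1) :
    ∫ θ, wS r {0, 1} (pairθ s θ) * Complex.exp (σS r {0, 1} (pairθ s θ) 0 * σS r {0, 1} (pairθ s θ) 1) ∂(Measure.pi (θS {0, 1})) =
      mixedDeriv [1, 0] (fun z : Fin 2 → ℂ => Complex.exp (z 0 * z 1)) (basePt {0, 1} s) :=
  mixedDerivLetter_rep_of_nodup r {0, 1} (fun z => Complex.exp (z 0 * z 1)) s hr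
    (((analyticOnNhd_apply 0).mul (analyticOnNhd_apply 1)).cexp) (fun j _ => hs j) (by decide) (fun j => by fin_cases j <;> simp)

end Summit.QuantumFields.BalabanUV.T4Continuum.NE1p.DressedSmallFieldMixedDerivativeSymmetric

end
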